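import Mathlib

/-!
# SoloBlindEulerFrame — the Euler-frame identities (Lemma E) behind the decimation proof of Conjecture L

solo `solo-MatrixMultiplication-blind`; evidence file
`run/shared/lean/ideation/MatrixMultiplication/solo-blind/paper/paper.md`, §17.15 (C) LEMMA E
(Koszul-flattening saturation of Kronecker powers of the small Coppersmith–Winograd tensor — a
CONSEQUENCE-side study; no bearing on `ω = 2` is claimed).

Setting (over an arbitrary commutative ring `R`).  The site algebra `B = R[z]/(z³ − 1)` is realised on
`Fin 3 → R` (basis `1, z, z²`) by the cyclic shift `soloEulerCyc`; `soloEulerLin a c` is multiplication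
by `a + c z`; `soloEulerD = diag(0, 1, −1)` is the site derivation (it acts on `z`-exponents); for weight
vectors `c m : Fin 4 → R` the matrix `soloEulerK4 c m` of `u ↦ c ∧ m ∧ u : R⁴ → Λ³R⁴ ≅ R⁴` has entries
`K4 t b = det (rows ≠ t of the 4 × 3 matrix [c | m | e_b])`.  The UNTWISTED gauged site operator on
`R⁴ ⊗ B = (Fin 4 × Fin 3 → R)` is `soloEulerSite a c m = (K4 ⊗ 1) * (1 ⊗ D) * G`, `G = ⊕_b (a_b + c_b z)`
(the paper's operator is `Φ * soloEulerSite` with `Φ` invertible, which changes neither the kernel nor —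
after transporting the functionals by `Φ` — the left-kernel statements below).

What is proved (all by computation):
* `soloEuler_lin_mul_adj` : `(a + c z)(a² − a c z + c² z²) = a³ + c³` in `B` (the inverse formula
  behind the frame vectors `g_r = (a_r + c_r z)⁻¹`);
* `soloEuler_K4_mulVec_c`, `soloEuler_K4_mulVec_m` : `c ∧ m ∧ c = 0`, `c ∧ m ∧ m = 0`;
* `soloEuler_alt_c_K4`, `soloEuler_alt_m_K4` : `Σ_t (−1)^t c_t K4 t b = 0` (the determinant of
  `[c | m | e_b | c]` expanded along its last column), and the same with `m`;
* LEMMA E, primal: `soloEulerSite a c m` kills `e_r ⊗ (a_r² , −a_r c_r, c_r²)` for every letter `r`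
  (`soloEuler_site_mulVec_frame`) and kills `𝟙 ⊗ 1` (`soloEuler_site_mulVec_ones`);
* LEMMA E, dual: the functionals `ê_s ⊗ τ` (`τ` = the `z⁰`-coefficient) and
  `Σ_t (−1)^t ê_t ⊗ τ((a_t + c_t z) · )` kill `soloEulerSite a c m` from the left
  (`soloEuler_frameDual_vecMul_site`, `soloEuler_topDual_vecMul_site`).

INFORMAL CONTEXT (not formalised here): in the evidence file these identities say that the five Euler
product vectors and the five dual Euler products are annihilated by every site operator of the leading
form `M1` of the `(5,2)` Koszul flattening, for all parameters; together with a rank-one "telescoping"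
formula, a hierarchical Schur-complement bound and two exact rank certificates this proves that
`corank M1 = 5` generically for every number of sites `k ≥ 4` (Theorem 17.15 there).  None of that
consequence is proved in this file.  Standard axioms; the definitions below are local abbreviations.
-/

namespace Summit.MatrixMultiplication.MatrixMultiplication.Theorems

open Matrix
open scoped Kronecker

section

variable {R : Type*} [CommRing R]

/-- The cyclic shift `z` on `B = R[z]/(z³−1)` in the basis `1, z, z²`: `z e₀ = e₁, z e₁ = e₂, z e₂ = e₀`. -/
def soloEulerCyc : Matrix (Fin 3) (Fin 3) R := !![0, 0, 1; 1, 0, 0; 0, 1, 0]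

/-- Multiplication by `a + c z` on `B`. -/
def soloEulerLin (a c : R) : Matrix (Fin 3) (Fin 3) R := a • (1 : Matrix (Fin 3) (Fin 3) R) + c • soloEulerCyc

/-- Multiplication by `a² − a c z + c² z²` on `B` (the adjugate of `a + c z`: their product is `a³ + c³`). -/
def soloEulerAdj (a c : R) : Matrix (Fin 3) (Fin 3) R :=
  (a ^ 2) • (1 : Matrix (Fin 3) (Fin 3) R) - (a * c) • soloEulerCyc + (c ^ 2) • (soloEulerCyc * soloEulerCyc)

/-- The site derivation `D = diag(0, 1, −1)` (on `z`-exponents). -/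
def soloEulerD : Matrix (Fin 3) (Fin 3) R := Matrix.diagonal ![0, 1, -1]

/-- The rows other than `t`, in increasing order (this is `Fin.succAbove t`). -/
def soloEulerRows : Fin 4 → Fin 3 → Fin 4 := ![![1, 2, 3], ![0, 2, 3], ![0, 1, 3], ![0, 1, 2]]

/-- `soloEulerRows t` lists the rows other than `t` in increasing order, i.e. it is `Fin.succAbove t`. -/
theorem soloEulerRows_eq_succAbove (t : Fin 4) (i : Fin 3) : soloEulerRows t i = t.succAbove i := by
  fin_cases t <;> fin_cases i <;> rfl

/-- `K4 t b = det (rows ≠ t of [c | m | e_b])`: the matrix of `u ↦ c ∧ m ∧ u`, `R⁴ → Λ³ R⁴ ≅ R⁴`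
(`ê_t` = the coordinate omitting `t`). -/
def soloEulerK4 (c m : Fin 4 → R) : Matrix (Fin 4) (Fin 4) R :=
  Matrix.of fun t b => Matrix.det (Matrix.of fun i j =>
    ![c (soloEulerRows t i), m (soloEulerRows t i), if soloEulerRows t i = b then (1 : R) else 0] j)

/-- The alternating sign `(−1)^t`. -/
def soloEulerSgn : Fin 4 → R := ![1, -1, 1, -1]

/-- The block-diagonal multiplication operator `G = ⊕_b (a_b + c_b z)` on `R⁴ ⊗ B`. -/
def soloEulerG (a c : Fin 4 → R) : Matrix (Fin 4 × Fin 3) (Fin 4 × Fin 3) R :=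
  Matrix.of fun p q => if p.1 = q.1 then soloEulerLin (a p.1) (c p.1) p.2 q.2 else 0

/-- The untwisted gauged site operator `(K4 ⊗ 1) * (1 ⊗ D) * G` on `R⁴ ⊗ B` (weights `a c m`). -/
def soloEulerSite (a c m : Fin 4 → R) : Matrix (Fin 4 × Fin 3) (Fin 4 × Fin 3) R :=
  (soloEulerK4 c m ⊗ₖ (1 : Matrix (Fin 3) (Fin 3) R)) * ((1 : Matrix (Fin 4) (Fin 4) R) ⊗ₖ soloEulerD)
    * soloEulerG a c

/-! ### The scalar identities -/

/-- `(a + c z)(a² − a c z + c² z²) = a³ + c³` in `B = R[z]/(z³ − 1)`. -/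
theorem soloEuler_lin_mul_adj (a c : R) :
    soloEulerLin a c * soloEulerAdj a c = (a ^ 3 + c ^ 3) • (1 : Matrix (Fin 3) (Fin 3) R) := by
  ext i j
  simp only [soloEulerLin, soloEulerAdj, soloEulerCyc]
  fin_cases i <;> fin_cases j <;> simp [Matrix.mul_apply, Fin.sum_univ_three, Matrix.one_apply] <;> ring

/-- `z³ = 1`. -/
theorem soloEuler_cyc_pow_three :
    (soloEulerCyc : Matrix (Fin 3) (Fin 3) R) * soloEulerCyc * soloEulerCyc = 1 := by
  ext i j
  fin_cases i <;> fin_cases j <;> simp [soloEulerCyc, Matrix.mul_apply, Fin.sum_univ_three]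

/-- `D 1 = 0` and `τ ∘ D = 0` (`τ` = the `z⁰`-coefficient): the two facts about the derivation used. -/
theorem soloEuler_D_mulVec_one : (soloEulerD : Matrix (Fin 3) (Fin 3) R) *ᵥ ![1, 0, 0] = 0 := by
  ext i; fin_cases i <;> simp [soloEulerD, Matrix.mulVec, dotProduct, Matrix.diagonal]

/-- `τ ∘ D = 0`: the `z⁰`-coefficient of `D v` vanishes for every `v`. -/
theorem soloEuler_tau_D (v : Fin 3 → R) : ((soloEulerD : Matrix (Fin 3) (Fin 3) R) *ᵥ v) 0 = 0 := by
  simp [soloEulerD, Matrix.mulVec, dotProduct, Matrix.diagonal]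

/-- `c ∧ m ∧ c = 0`. -/
theorem soloEuler_K4_mulVec_c (c m : Fin 4 → R) : soloEulerK4 c m *ᵥ c = 0 := by
  ext t
  fin_cases t <;>
    simp [soloEulerK4, soloEulerRows, Matrix.mulVec, dotProduct, Fin.sum_univ_four, Matrix.det_fin_three] <;>
    ring

/-- `c ∧ m ∧ m = 0`. -/
theorem soloEuler_K4_mulVec_m (c m : Fin 4 → R) : soloEulerK4 c m *ᵥ m = 0 := by
  ext t
  fin_cases t <;>
    simp [soloEulerK4, soloEulerRows, Matrix.mulVec, dotProduct, Fin.sum_univ_four, Matrix.det_fin_three] <;>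
    ring

/-- `Σ_t (−1)^t c_t · det(rows ≠ t of [c | m | e_b]) = det [c | m | e_b | c] = 0`. -/
theorem soloEuler_alt_c_K4 (c m : Fin 4 → R) (b : Fin 4) :
    ∑ t : Fin 4, soloEulerSgn t * c t * soloEulerK4 c m t b = 0 := by
  fin_cases b <;>
    simp [soloEulerK4, soloEulerRows, soloEulerSgn, Fin.sum_univ_four, Matrix.det_fin_three] <;> ring

/-- The same with `m`: `det [c | m | e_b | m] = 0`. -/
theorem soloEuler_alt_m_K4 (c m : Fin 4 → R) (b : Fin 4) :
    ∑ t : Fin 4, soloEulerSgn t * m t * soloEulerK4 c m t b = 0 := by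
  fin_cases b <;>
    simp [soloEulerK4, soloEulerRows, soloEulerSgn, Fin.sum_univ_four, Matrix.det_fin_three] <;> ring

/-! ### Lemma E — primal side: the Euler product vectors are killed by the site operator -/

/-- `G (e_r ⊗ adj_r) = (a_r³ + c_r³) · e_r ⊗ 1`. -/
theorem soloEuler_G_mulVec_frame (a c : Fin 4 → R) (r : Fin 4) :
    soloEulerG a c *ᵥ (fun q => if q.1 = r then (soloEulerAdj (a r) (c r) *ᵥ ![1, 0, 0]) q.2 else 0)
      = fun q => if q.1 = r then (a r ^ 3 + c r ^ 3) * (![1, 0, 0] : Fin 3 → R) q.2 else 0 := by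
  have key : soloEulerLin (a r) (c r) *ᵥ (soloEulerAdj (a r) (c r) *ᵥ ![1, 0, 0])
      = fun i => (a r ^ 3 + c r ^ 3) * (![1, 0, 0] : Fin 3 → R) i := by
    ext i
    fin_cases i <;>
      simp [soloEulerLin, soloEulerAdj, soloEulerCyc, Matrix.mulVec, dotProduct, Fin.sum_univ_three,
        Matrix.one_apply] <;> ring
  ext ⟨b, q⟩
  simp only [soloEulerG, Matrix.mulVec, dotProduct, Fintype.sum_prod_type, Matrix.of_apply]
  by_cases hb : b = r
  · subst hb
    have := congrFun key q
    simp only [Matrix.mulVec, dotProduct] at this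
    simp [Finset.sum_ite_eq', this]
  · simp [hb]

/-- `(1 ⊗ D)` kills `e_r ⊗ 1`. -/
theorem soloEuler_oneD_mulVec_frame (r : Fin 4) (s : R) :
    ((1 : Matrix (Fin 4) (Fin 4) R) ⊗ₖ (soloEulerD : Matrix (Fin 3) (Fin 3) R))
        *ᵥ (fun q : Fin 4 × Fin 3 => if q.1 = r then s * (![1, 0, 0] : Fin 3 → R) q.2 else 0) = 0 := by
  ext ⟨b, q⟩
  simp only [Matrix.mulVec, dotProduct, Fintype.sum_prod_type, Matrix.kroneckerMap_apply, Pi.zero_apply]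
  fin_cases q <;> simp [soloEulerD, Matrix.one_apply, Matrix.diagonal]

/-- LEMMA E (primal, letters): the site operator kills `e_r ⊗ (a_r² − a_r c_r z + c_r² z²)`
(`= (a_r³ + c_r³) · e_r ⊗ (a_r + c_r z)⁻¹` whenever `a_r³ + c_r³` is a unit). -/
theorem soloEuler_site_mulVec_frame (a c m : Fin 4 → R) (r : Fin 4) :
    soloEulerSite a c m *ᵥ (fun q => if q.1 = r then (soloEulerAdj (a r) (c r) *ᵥ ![1, 0, 0]) q.2 else 0)
      = 0 := by
  unfold soloEulerSite
  rw [← Matrix.mulVec_mulVec, ← Matrix.mulVec_mulVec, soloEuler_G_mulVec_frame,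
    soloEuler_oneD_mulVec_frame, Matrix.mulVec_zero]

/-- `G (𝟙 ⊗ 1) = Σ_b e_b ⊗ (a_b + c_b z)`. -/
theorem soloEuler_G_mulVec_ones (a c : Fin 4 → R) :
    soloEulerG a c *ᵥ (fun q => (![1, 0, 0] : Fin 3 → R) q.2)
      = fun q => (![a q.1, c q.1, 0] : Fin 3 → R) q.2 := by
  ext ⟨b, q⟩
  simp only [soloEulerG, Matrix.mulVec, dotProduct, Fintype.sum_prod_type, Matrix.of_apply]
  fin_cases q <;>
    simp [soloEulerLin, soloEulerCyc, Fin.sum_univ_three, Matrix.one_apply]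

/-- `(1 ⊗ D) (Σ_b e_b ⊗ (a_b + c_b z)) = Σ_b c_b · e_b ⊗ z`. -/
theorem soloEuler_oneD_mulVec_lin (a c : Fin 4 → R) :
    ((1 : Matrix (Fin 4) (Fin 4) R) ⊗ₖ (soloEulerD : Matrix (Fin 3) (Fin 3) R))
        *ᵥ (fun q : Fin 4 × Fin 3 => (![a q.1, c q.1, 0] : Fin 3 → R) q.2)
      = fun q => (![0, c q.1, 0] : Fin 3 → R) q.2 := by
  ext ⟨b, q⟩
  simp only [Matrix.mulVec, dotProduct, Fintype.sum_prod_type, Matrix.kroneckerMap_apply]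
  fin_cases q <;> simp [soloEulerD, Matrix.one_apply, Matrix.diagonal]

/-- `(K4 ⊗ 1) (Σ_b c_b · e_b ⊗ z) = (c ∧ m ∧ c) ⊗ z = 0`. -/
theorem soloEuler_K4one_mulVec_cz (c m : Fin 4 → R) :
    (soloEulerK4 c m ⊗ₖ (1 : Matrix (Fin 3) (Fin 3) R))
        *ᵥ (fun q : Fin 4 × Fin 3 => (![0, c q.1, 0] : Fin 3 → R) q.2) = 0 := by
  have hc := soloEuler_K4_mulVec_c c m
  ext ⟨t, q⟩
  have ht := congrFun hc t
  simp only [Matrix.mulVec, dotProduct, Pi.zero_apply] at ht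
  simp only [Matrix.mulVec, dotProduct, Fintype.sum_prod_type, Matrix.kroneckerMap_apply, Pi.zero_apply]
  fin_cases q <;> simp [Matrix.one_apply, ht]

/-- LEMMA E (primal, centre): the site operator kills `𝟙 ⊗ 1`. -/
theorem soloEuler_site_mulVec_ones (a c m : Fin 4 → R) :
    soloEulerSite a c m *ᵥ (fun q => (![1, 0, 0] : Fin 3 → R) q.2) = 0 := by
  unfold soloEulerSite
  rw [← Matrix.mulVec_mulVec, ← Matrix.mulVec_mulVec, soloEuler_G_mulVec_ones, soloEuler_oneD_mulVec_lin,
    soloEuler_K4one_mulVec_cz]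

/-! ### Lemma E — dual side: the dual Euler functionals kill the site operator from the left -/

/-- `(ê_s ⊗ τ) (K4 ⊗ 1) = Σ_b K4 s b · (ê_b ⊗ τ)`. -/
theorem soloEuler_frameDual_vecMul_K4one (c m : Fin 4 → R) (s : Fin 4) :
    (fun p : Fin 4 × Fin 3 => if p.1 = s then (![1, 0, 0] : Fin 3 → R) p.2 else 0)
        ᵥ* (soloEulerK4 c m ⊗ₖ (1 : Matrix (Fin 3) (Fin 3) R))
      = fun q => soloEulerK4 c m s q.1 * (![1, 0, 0] : Fin 3 → R) q.2 := by
  ext ⟨b, q⟩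
  simp only [Matrix.vecMul, dotProduct, Fintype.sum_prod_type, Matrix.kroneckerMap_apply]
  fin_cases q <;> simp [Matrix.one_apply, Finset.sum_ite_eq']

/-- `(Σ_b x_b · ê_b ⊗ τ) (1 ⊗ D) = 0` because the `z⁰`-row of `D` vanishes. -/
theorem soloEuler_tauRow_vecMul_oneD (x : Fin 4 → R) :
    (fun p : Fin 4 × Fin 3 => x p.1 * (![1, 0, 0] : Fin 3 → R) p.2)
        ᵥ* ((1 : Matrix (Fin 4) (Fin 4) R) ⊗ₖ (soloEulerD : Matrix (Fin 3) (Fin 3) R)) = 0 := by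
  ext ⟨b, q⟩
  simp only [Matrix.vecMul, dotProduct, Fintype.sum_prod_type, Matrix.kroneckerMap_apply, Pi.zero_apply]
  fin_cases q <;> simp [soloEulerD, Matrix.one_apply, Matrix.diagonal]

/-- LEMMA E (dual, letters): `(ê_s ⊗ τ) * soloEulerSite = 0` (in the paper: `(ê_s ⊗ β_s) Φ = ê_s ⊗ τ`). -/
theorem soloEuler_frameDual_vecMul_site (a c m : Fin 4 → R) (s : Fin 4) :
    (fun p : Fin 4 × Fin 3 => if p.1 = s then (![1, 0, 0] : Fin 3 → R) p.2 else 0)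
        ᵥ* soloEulerSite a c m = 0 := by
  unfold soloEulerSite
  rw [← Matrix.vecMul_vecMul, ← Matrix.vecMul_vecMul, soloEuler_frameDual_vecMul_K4one,
    soloEuler_tauRow_vecMul_oneD, Matrix.zero_vecMul]

/-- The coefficient `A_b = Σ_t (−1)^t a_t K4 t b` (it is killed by `D` afterwards, so its value is irrelevant). -/
def soloEulerTopA (a c m : Fin 4 → R) (b : Fin 4) : R :=
  ∑ t : Fin 4, soloEulerSgn t * a t * soloEulerK4 c m t b

/-- `(Σ_t (−1)^t ê_t ⊗ τ((a_t + c_t z)·)) (K4 ⊗ 1) = Σ_b A_b · (ê_b ⊗ τ)`: the `z²`-coefficient row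
vanishes by `soloEuler_alt_c_K4`.  Here `τ((a + c z) f) = a f₀ + c f₂` is the row vector `(a, 0, c)`. -/
theorem soloEuler_topDual_vecMul_K4one (a c m : Fin 4 → R) :
    (fun p : Fin 4 × Fin 3 => soloEulerSgn p.1 * (![a p.1, 0, c p.1] : Fin 3 → R) p.2)
        ᵥ* (soloEulerK4 c m ⊗ₖ (1 : Matrix (Fin 3) (Fin 3) R))
      = fun q => soloEulerTopA a c m q.1 * (![1, 0, 0] : Fin 3 → R) q.2 := by
  ext ⟨b, q⟩
  have hz := soloEuler_alt_c_K4 c m b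
  simp only [Fin.sum_univ_four, soloEulerSgn] at hz
  simp only [Matrix.vecMul, dotProduct, Fintype.sum_prod_type, Matrix.kroneckerMap_apply, soloEulerTopA]
  fin_cases q
  · simp [Fin.sum_univ_four, Matrix.one_apply, soloEulerSgn]
  · simp [Fin.sum_univ_four, Matrix.one_apply, soloEulerSgn]
  · simp [Fin.sum_univ_four, Matrix.one_apply, soloEulerSgn]
    simp at hz
    linear_combination hz

/-- LEMMA E (dual, centre): `(Σ_t (−1)^t ê_t ⊗ τ((a_t + c_t z)·)) * soloEulerSite = 0`
(in the paper: `(Σ_t (−1)^t ê_t ⊗ τ(ρ ·)) Φ = Σ_t (−1)^t ê_t ⊗ τ((a_t + c_t z) ·)`). -/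
theorem soloEuler_topDual_vecMul_site (a c m : Fin 4 → R) :
    (fun p : Fin 4 × Fin 3 => soloEulerSgn p.1 * (![a p.1, 0, c p.1] : Fin 3 → R) p.2)
        ᵥ* soloEulerSite a c m = 0 := by
  unfold soloEulerSite
  rw [← Matrix.vecMul_vecMul, ← Matrix.vecMul_vecMul, soloEuler_topDual_vecMul_K4one,
    soloEuler_tauRow_vecMul_oneD, Matrix.zero_vecMul]

end

end Summit.MatrixMultiplication.MatrixMultiplication.Theorems
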